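import Summits.Ventures.Crystal3D.Theorems.StickyWulffConstantPolycrystalWulffBoundChargedArith

/-!
# `PolycrystalWulffBound`, line `PolyDensity`: arithmetic of the two-lattice rung AT THE CRUX'S CHARGE `1`
# (crux `stmt-Ventures-19482`; lane poly-p2, gen 24)

Route `StickyWulffConstant` of the venture `Summits/Ventures/Crystal3D`, second prover lane.  Pure real
arithmetic (Mathlib + the lane's decimal brackets), consumed by `…RungTwinFreeTwoClassesOne`:

* `rpow_two_thirds_chord` — CONCAVITY CHORDS: for `σ₁·V ≤ s ≤ σ₂·V` there is `θ ∈ [0,1]` with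
  `((1−θ)a₁ + θa₂)·V^{2/3} ≤ (V − s)^{2/3}` and `((1−θ)b₁ + θb₂)·V^{2/3} ≤ s^{2/3}` whenever
  `a_i ≤ (1−σ_i)^{2/3}`, `b_i ≤ σ_i^{2/3}` (so an LP that is linear in `θ` certifies a whole `σ`-interval);
* `ballCut_const_lower` — `9.327 ≤ 3·(π(24√3 − 32))^{1/3}` (the ball-cut body `W ∩ B̄(0,2)` has volume
  `≥ π(24√3 − 32) = 30.06`, tree lemma `volume_cruxWulffBody_inter_closedBall_two_ge`);
* `midBand_arith_one` — the MID-BAND corner at charge `1`: dominant class `v_D ∈ [(3/4)V, (17/20)V]`,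
  the energy split `F_D + F_S + A ≤ En`, per-class Wulff bounds `w(v_D) ≤ F_D + √5·A`,
  `w(s) ≤ F_S + √5·A`, the inradius bound `√3·Y ≤ F_S` and the NEW ball-cut row
  `3·(π(24√3−32))^{1/3}·V^{2/3} ≤ F_D + 2·Y` ⟹ `w(V) ≤ En` (LP margin `0.29 %`, dual multipliers
  `0.2794 / 0.1677 / 0.8323 / 0.7206`);
* `twoClass_arith_one` — the BALANCED corner at charge `1`: both classes `≥ V/4`, overlap `26.61`
  (margin `0.33 %`); decimal brackets `rpow_three_quarters_lower`, `rpow_one_quarter_lower`.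
WHAT THIS IS NOT: geometry; the crux is not claimed.
-/

noncomputable section

namespace Summit.Ventures.Crystal3D.Cruxes.PolycrystalWulffBound.PolyDensity

open Real Finset Summit.Ventures.Crystal3D.Theorems

/-! ### Decimal brackets -/

/-- `0.8254 ≤ (3/4)^{2/3}`. -/
theorem rpow_three_quarters_lower : (0.8254 : ℝ) ≤ (3 / 4 : ℝ) ^ ((2 : ℝ) / 3) :=
  rpow_two_thirds_lower_of_cube (by norm_num) (by norm_num) (by norm_num)

/-- `0.3968 ≤ (1/4)^{2/3}`. -/
theorem rpow_one_quarter_lower : (0.3968 : ℝ) ≤ (1 / 4 : ℝ) ^ ((2 : ℝ) / 3) :=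
  rpow_two_thirds_lower_of_cube (by norm_num) (by norm_num) (by norm_num)

/-- **The ball-cut constant**: `9.327 ≤ 3·(π(24√3 − 32))^{1/3}` (`π(24√3 − 32) = 30.06…`, cube root
`3.1096…`). -/
theorem ballCut_const_lower :
    (9.327 : ℝ) ≤ 3 * (Real.pi * (24 * Real.sqrt 3 - 32)) ^ ((1 : ℝ) / 3) := by
  have h3 := sqrt_three_lower_fine
  have hπ := Real.pi_gt_d6
  have hx : (3.109 : ℝ) ^ 3 ≤ Real.pi * (24 * Real.sqrt 3 - 32) := by
    nlinarith [mul_le_mul_of_nonneg_left h3 (le_of_lt Real.pi_pos)]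
  have h := le_rpow_third_of_cube_le (by norm_num) hx
  linarith

/-! ### Concavity chords -/

/-- **Concavity chords of `x ↦ x^{2/3}` on a volume interval.**  For `0 < σ₁ < σ₂ < 1`, decimal lower
bounds `a_i ≤ (1 − σ_i)^{2/3}`, `b_i ≤ σ_i^{2/3}`, `V ≥ 0` and `σ₁·V ≤ s ≤ σ₂·V` there is `θ ∈ [0,1]`
with `((1−θ)·a₁ + θ·a₂)·V^{2/3} ≤ (V − s)^{2/3}` and `((1−θ)·b₁ + θ·b₂)·V^{2/3} ≤ s^{2/3}`
(`s = (1−θ)·σ₁V + θ·σ₂V`; both maps are concave). -/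
theorem rpow_two_thirds_chord {σ₁ σ₂ a₁ a₂ b₁ b₂ V s : ℝ} (hσ₁ : 0 < σ₁) (hσ₁₂ : σ₁ < σ₂)
    (hσ₂ : σ₂ < 1) (ha₁ : a₁ ≤ (1 - σ₁) ^ ((2 : ℝ) / 3)) (ha₂ : a₂ ≤ (1 - σ₂) ^ ((2 : ℝ) / 3))
    (hb₁ : b₁ ≤ σ₁ ^ ((2 : ℝ) / 3)) (hb₂ : b₂ ≤ σ₂ ^ ((2 : ℝ) / 3)) (hV : 0 ≤ V)
    (hs₁ : σ₁ * V ≤ s) (hs₂ : s ≤ σ₂ * V) :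
    ∃ θ : ℝ, 0 ≤ θ ∧ θ ≤ 1 ∧
      ((1 - θ) * a₁ + θ * a₂) * V ^ ((2 : ℝ) / 3) ≤ (V - s) ^ ((2 : ℝ) / 3) ∧
      ((1 - θ) * b₁ + θ * b₂) * V ^ ((2 : ℝ) / 3) ≤ s ^ ((2 : ℝ) / 3) := by
  rcases hV.eq_or_lt with hV0 | hVpos
  · -- `V = 0`, hence `s = 0`
    have hs0 : s = 0 := by
      apply le_antisymm
      · rw [← hV0] at hs₂; simpa using hs₂
      · rw [← hV0] at hs₁; simpa using hs₁
    refine ⟨0, le_rfl, zero_le_one, ?_, ?_⟩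
    · rw [← hV0, hs0, sub_zero, Real.zero_rpow (by norm_num)]; simp
    · rw [← hV0, hs0, Real.zero_rpow (by norm_num)]; simp
  set θ : ℝ := (s - σ₁ * V) / ((σ₂ - σ₁) * V) with hθ
  have hden : 0 < (σ₂ - σ₁) * V := mul_pos (by linarith) hVpos
  have hθ0 : 0 ≤ θ := div_nonneg (by linarith) hden.le
  have hθ1 : θ ≤ 1 := (div_le_one hden).2 (by nlinarith)
  have hθs : θ * ((σ₂ - σ₁) * V) = s - σ₁ * V := div_mul_cancel₀ _ hden.ne'
  have e1 : (1 - θ) * (σ₁ * V) + θ * (σ₂ * V) = s := by nlinarith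
  have e2 : (1 - θ) * ((1 - σ₁) * V) + θ * ((1 - σ₂) * V) = V - s := by nlinarith
  have hconc := (Real.concaveOn_rpow (p := (2 : ℝ) / 3) (by norm_num) (by norm_num)).2
  have h1σ₁ : 0 ≤ 1 - σ₁ := by linarith
  have h1σ₂ : 0 ≤ 1 - σ₂ := by linarith
  have hm₁ : (σ₁ * V) ∈ Set.Ici (0 : ℝ) := Set.mem_Ici.2 (by positivity)
  have hm₂ : (σ₂ * V) ∈ Set.Ici (0 : ℝ) := Set.mem_Ici.2 (by nlinarith)
  have hn₁ : ((1 - σ₁) * V) ∈ Set.Ici (0 : ℝ) := Set.mem_Ici.2 (by positivity)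
  have hn₂ : ((1 - σ₂) * V) ∈ Set.Ici (0 : ℝ) := Set.mem_Ici.2 (by positivity)
  have hB : (1 - θ) * (σ₁ * V) ^ ((2 : ℝ) / 3) + θ * (σ₂ * V) ^ ((2 : ℝ) / 3) ≤
      s ^ ((2 : ℝ) / 3) := by
    have h := hconc hm₁ hm₂ (sub_nonneg.2 hθ1) hθ0 (by ring)
    simp only [smul_eq_mul] at h
    rwa [e1] at h
  have hA : (1 - θ) * ((1 - σ₁) * V) ^ ((2 : ℝ) / 3) + θ * ((1 - σ₂) * V) ^ ((2 : ℝ) / 3) ≤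
      (V - s) ^ ((2 : ℝ) / 3) := by
    have h := hconc hn₁ hn₂ (sub_nonneg.2 hθ1) hθ0 (by ring)
    simp only [smul_eq_mul] at h
    rwa [e2] at h
  rw [Real.mul_rpow hσ₁.le hV, Real.mul_rpow (by linarith : (0 : ℝ) ≤ σ₂) hV] at hB
  rw [Real.mul_rpow h1σ₁ hV, Real.mul_rpow h1σ₂ hV] at hA
  have hW0 : 0 ≤ V ^ ((2 : ℝ) / 3) := by positivity
  have h1θ : 0 ≤ 1 - θ := sub_nonneg.2 hθ1
  refine ⟨θ, hθ0, hθ1, ?_, ?_⟩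
  · nlinarith [mul_le_mul_of_nonneg_left (mul_le_mul_of_nonneg_right ha₁ hW0) h1θ,
      mul_le_mul_of_nonneg_left (mul_le_mul_of_nonneg_right ha₂ hW0) hθ0]
  · nlinarith [mul_le_mul_of_nonneg_left (mul_le_mul_of_nonneg_right hb₁ hW0) h1θ,
      mul_le_mul_of_nonneg_left (mul_le_mul_of_nonneg_right hb₂ hW0) hθ0]

/-! ### The mid-band corner at charge `1` -/

set_option maxHeartbeats 400000 in
/-- **Mid-band corner at charge `1` (arithmetic).**  Volumes `V = v_D + s` with
`(3/4)·V ≤ v_D ≤ (17/20)·V`; free energies `F_D, F_S`, satellite exterior area `Y ≥ 0` and interface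
`A ≥ 0` with the energy split `F_D + F_S + A ≤ En`, the per-class Wulff bounds `w(v_D) ≤ F_D + √5·A`,
`w(s) ≤ F_S + √5·A`, the inradius bound `√3·Y ≤ F_S`, and the ball-cut row
`3·(π(24√3−32))^{1/3}·V^{2/3} ≤ F_D + 2·Y`.  Then `w(V) ≤ En` (`w(v) = 6·2^{1/3}(√2 v)^{2/3}`).
LP dual: `0.2794·[per-class D] + 0.1677·[per-class S] + 0.8323·[inradius] + 0.7206·[ball cut]`. -/
theorem midBand_arith_one {V vD s FD FS Y A En : ℝ} (hV : V = vD + s) (hs0 : 0 ≤ s)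
    (hlo : 3 / 4 * V ≤ vD) (hhi : vD ≤ 17 / 20 * V) (hY : 0 ≤ Y) (hA : 0 ≤ A)
    (hsplit : FD + FS + A ≤ En)
    (hD : 6 * (2 : ℝ) ^ ((1 : ℝ) / 3) * (Real.sqrt 2 * vD) ^ ((2 : ℝ) / 3) ≤ FD + Real.sqrt 5 * A)
    (hS : 6 * (2 : ℝ) ^ ((1 : ℝ) / 3) * (Real.sqrt 2 * s) ^ ((2 : ℝ) / 3) ≤ FS + Real.sqrt 5 * A)
    (hYS : Real.sqrt 3 * Y ≤ FS)
    (hball : 3 * (Real.pi * (24 * Real.sqrt 3 - 32)) ^ ((1 : ℝ) / 3) * V ^ ((2 : ℝ) / 3) ≤ FD + 2 * Y) :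
    6 * (2 : ℝ) ^ ((1 : ℝ) / 3) * (Real.sqrt 2 * V) ^ ((2 : ℝ) / 3) ≤ En := by
  have hV0 : 0 ≤ V := by nlinarith
  have hvD0 : 0 ≤ vD := by nlinarith
  rw [wulffConstant_eq' hV0]
  rw [wulffConstant_eq' hvD0] at hD
  rw [wulffConstant_eq' hs0] at hS
  obtain ⟨ht1, ht2, -⟩ := cbrt_two_bounds
  set t : ℝ := (2 : ℝ) ^ ((1 : ℝ) / 3) with ht
  have ht0 : 0 ≤ t := by positivity
  -- the chords on `s ∈ [(3/20)V, (1/4)V]`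
  have hs₁ : 3 / 20 * V ≤ s := by linarith
  have hs₂ : s ≤ 1 / 4 * V := by linarith
  obtain ⟨θ, hθ0, hθ1, hA', hB'⟩ := rpow_two_thirds_chord (σ₁ := 3 / 20) (σ₂ := 1 / 4)
    (a₁ := 0.8973) (a₂ := 0.8254) (b₁ := 0.2823) (b₂ := 0.3968) (by norm_num) (by norm_num)
    (by norm_num) (by rw [show (1 - 3 / 20 : ℝ) = 17 / 20 by norm_num]; exact rpow_seventeen_twentieths_lower)
    (by rw [show (1 - 1 / 4 : ℝ) = 3 / 4 by norm_num]; exact rpow_three_quarters_lower)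
    rpow_three_twentieths_lower rpow_one_quarter_lower hV0 hs₁ hs₂
  rw [show V - s = vD by rw [hV]; ring] at hA'
  set W : ℝ := V ^ ((2 : ℝ) / 3) with hW
  set WD : ℝ := vD ^ ((2 : ℝ) / 3) with hWD
  set WS : ℝ := s ^ ((2 : ℝ) / 3) with hWS
  have hW0 : 0 ≤ W := by positivity
  have hWD0 : 0 ≤ WD := by positivity
  have hWS0 : 0 ≤ WS := by positivity
  have h5u : Real.sqrt 5 ≤ (2.2361 : ℝ) := sqrt_five_upper
  have h3l : (1.732 : ℝ) ≤ Real.sqrt 3 := sqrt_three_lower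
  have hbc := ballCut_const_lower
  have ht2l : (1.2599 : ℝ) ^ 2 ≤ t ^ 2 := by gcongr
  have ht2u : t ^ 2 ≤ (1.25993 : ℝ) ^ 2 := by gcongr
  -- the rows with decimal constants
  have p1 : 6 * (1.2599 : ℝ) ^ 2 * WD ≤ FD + 2.2361 * A := by
    nlinarith [mul_le_mul_of_nonneg_right ht2l hWD0, mul_le_mul_of_nonneg_right h5u hA]
  have p2 : 6 * (1.2599 : ℝ) ^ 2 * WS ≤ FS + 2.2361 * A := by
    nlinarith [mul_le_mul_of_nonneg_right ht2l hWS0, mul_le_mul_of_nonneg_right h5u hA]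
  have p3 : (1.732 : ℝ) * Y ≤ FS := le_trans (mul_le_mul_of_nonneg_right h3l hY) hYS
  have p4 : (9.327 : ℝ) * W ≤ FD + 2 * Y := le_trans (mul_le_mul_of_nonneg_right hbc hW0) hball
  have p5 : 6 * t ^ 2 * W ≤ 6 * (1.25993 : ℝ) ^ 2 * W := by
    nlinarith [mul_le_mul_of_nonneg_right ht2u hW0]
  -- chords times the (nonnegative) multipliers
  have q1 : ((1 - θ) * 0.8973 + θ * 0.8254) * W ≤ WD := hA'
  have q2 : ((1 - θ) * 0.2823 + θ * 0.3968) * W ≤ WS := hB'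
  nlinarith [p1, p2, p3, p4, p5, q1, q2, hθ0, hθ1, hW0, hWD0, hWS0, hY, hA,
    mul_nonneg hθ0 hW0, mul_nonneg (sub_nonneg.2 hθ1) hW0]

/-! ### The balanced two-class corner at charge `1` -/

/-- **Two-class corner at charge `1` (arithmetic).**  `V = v₁ + v₂` with both `v_i ≥ V/4`,
`V_K ≥ 26.61`, `D ≥ 0`, `3·V_K^{1/3}·V^{2/3} + (1/2)·D ≤ En` and `w(v₁) + w(v₂) − (√5 − 1/2)·D ≤ En`
⟹ `w(V) ≤ En` (margin `0.33 %`). -/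
theorem twoClass_arith_one {V v₁ v₂ VK D En : ℝ} (hV : V = v₁ + v₂) (h1 : 1 / 4 * V ≤ v₁)
    (h2 : 1 / 4 * V ≤ v₂) (hVK : (26.61 : ℝ) ≤ VK) (hD : 0 ≤ D)
    (hK : 3 * VK ^ ((1 : ℝ) / 3) * V ^ ((2 : ℝ) / 3) + 1 / 2 * D ≤ En)
    (hP : 6 * (2 : ℝ) ^ ((1 : ℝ) / 3) * (Real.sqrt 2 * v₁) ^ ((2 : ℝ) / 3) +
      6 * (2 : ℝ) ^ ((1 : ℝ) / 3) * (Real.sqrt 2 * v₂) ^ ((2 : ℝ) / 3) -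
        (Real.sqrt 5 - 1 / 2) * D ≤ En) :
    6 * (2 : ℝ) ^ ((1 : ℝ) / 3) * (Real.sqrt 2 * V) ^ ((2 : ℝ) / 3) ≤ En := by
  have hV0 : 0 ≤ V := by nlinarith
  have hv1 : 0 ≤ v₁ := le_trans (by positivity) h1
  have hv2 : 0 ≤ v₂ := le_trans (by positivity) h2
  rw [wulffConstant_eq' hV0]
  rw [wulffConstant_eq' hv1, wulffConstant_eq' hv2] at hP
  obtain ⟨ht1, ht2, -⟩ := cbrt_two_bounds
  set t : ℝ := (2 : ℝ) ^ ((1 : ℝ) / 3) with ht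
  have ht0 : 0 ≤ t := by positivity
  have hkey := rpow_two_thirds_two_classes_gen (σ := 1 / 4) (by norm_num) (by norm_num) hV h1 h2
  have ha := rpow_three_quarters_lower
  have hb := rpow_one_quarter_lower
  rw [show (1 - 1 / 4 : ℝ) = 3 / 4 by norm_num] at hkey
  set W : ℝ := V ^ ((2 : ℝ) / 3) with hW
  set W1 : ℝ := v₁ ^ ((2 : ℝ) / 3) with hW1
  set W2 : ℝ := v₂ ^ ((2 : ℝ) / 3) with hW2
  have hW0 : 0 ≤ W := by positivity
  have hW10 : 0 ≤ W1 := by positivity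
  have hW20 : 0 ≤ W2 := by positivity
  have hsum : (1.2222 : ℝ) * W ≤ W1 + W2 := by nlinarith [hkey, ha, hb, hW0]
  have hcbrt : (2.985 : ℝ) ≤ VK ^ ((1 : ℝ) / 3) :=
    le_rpow_third_of_cube_le (by norm_num) (le_trans (by norm_num) hVK)
  have h5u : Real.sqrt 5 ≤ (2.2361 : ℝ) := sqrt_five_upper
  have ht2l : (1.2599 : ℝ) ^ 2 ≤ t ^ 2 := by gcongr
  have ht2u : t ^ 2 ≤ (1.25993 : ℝ) ^ 2 := by gcongr
  have p1 : (2.985 : ℝ) * W ≤ VK ^ ((1 : ℝ) / 3) * W := mul_le_mul_of_nonneg_right hcbrt hW0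
  have p2 : (1.2599 : ℝ) ^ 2 * (W1 + W2) ≤ t ^ 2 * (W1 + W2) :=
    mul_le_mul_of_nonneg_right ht2l (by positivity)
  have p3 : t ^ 2 * W ≤ (1.25993 : ℝ) ^ 2 * W := mul_le_mul_of_nonneg_right ht2u hW0
  have p4 : (Real.sqrt 5 - 1 / 2) * D ≤ (2.2361 - 1 / 2) * D :=
    mul_le_mul_of_nonneg_right (by linarith) hD
  nlinarith [hK, hP, p1, p2, p3, p4, hsum, hD, hW0, hW10, hW20, sq_nonneg t]

end Summit.Ventures.Crystal3D.Cruxes.PolycrystalWulffBound.PolyDensity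

end
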